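import Summits.Ventures.PercRepro.RankLevelSetRuleQCellOne
import Summits.Ventures.PercRepro.RankLevelSetRuleQRhatFalse
import Summits.Ventures.PercRepro.RankLevelSetRuleQSliceOneBinom

/-!
# PercRepro — (R̂) HOLDS ON THE SLICE `#P = q − 1` (`u = 1`) FOR EVERY `q ≥ 1`, `k ≥ 2` (p4, gen 20;
paper proofs/P4-RHAT-REFUTATION.md §2: «for u ∈ {0, 1} the cap makes the termwise-in-j comparison true»)

RankLevelSetRuleQRhatFalse (p4 g19) refuted `RhatIneq` as a general statement (first failure `u = q − m = 6` at `q = 72`);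
RuleQCellOne / Ends (night-1 g14) proved it on the slices `m ∈ {0, 1, q}`. Here the slice `m = q − 1`, TERMWISE IN `j`:
for `q = m + 1 ≥ 1`, `k ≥ 2`, `1 ≤ j ≤ k − 1`:  `C(q+k, j)/C(q+j, q) ≤ Σ_{a ≤ m} C(m, a)·C(k+1, j)/m̂(q, m; a, j)`,
`m̂(q, q−1; a, j) = C(q+a, a) + j·C(q+a, a+1)`. (A) `C(q+k, j)/C(k+1, j)` is non-increasing in `k`
(`choose_ratio_le_of_succ_le`, RankLevelSetRuleQSliceOneBinom), so the left side is at most its value at `k = j+1`, `C(k+1, j)·2(q+j+1)/((q+1)(j+1)(j+2))`.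
(B) With `B := C(2q−1, q)`, `W_a := C(2q−1, q+a)` the `a`-th term is `(W_a/B)·(a+1)/(a+1+jq)`: for `j = 1` the sum is EXACTLY
`1/2` (`Σ_{a<q} (a+1)·C(2q, q+1+a) = q·B`); for `j ≥ 2` the chord `(a+1)/(a+1+jq) ≥ (a+1)/((j+1)q)` and
`2·Σ_{a<q} (a+1)·W_a = 4^{q−1} + q·B` reduce it to `4^{q−1}(q+1) ≥ 2q·B` (`two_mul_succ_mul_choose_le`) and `(j−2)(q−1) ≥ 0`.
* `rhatCell_pred` — `Φ(q+k, q) ≤ R̂(q, k, q−1)` for all `q ≥ 1`, `k ≥ 2`;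
* **`ruleQRecv_ge_of_flatPart_eq_pred`** — Rule Q pays `Φ` to every member with `#P = q − 1` of every finite matroid at the
  tight layer of every cell `(q+k, q)` (with RuleQCellOne / Ends: every member with `#P ∈ {0, 1, q−1, q}`).
Twin: lean-drafts/p4/g20/slice/twin/slice_u1.py (termwise ratio ≥ 1.12 at `(q,k,j) = (2,3,2)`, `q ≤ 40`, `k ≤ 15`). Axioms: standard.
-/

namespace PercRepro

open Finset

/-! ### §3 The slice `m = q − 1` of `m̂`, and the per-term bounds -/

/-- On the slice `u = 1`: `m̂(m+1, m; a, j) = C(m+1+a, a) + j·C(m+1+a, a+1)` for `j ≥ 1`. -/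
lemma mhat_pred (m a j : ℕ) (hj : 1 ≤ j) :
    mhat (m + 1) m a j = (m + 1 + a).choose a + j * (m + 1 + a).choose (a + 1) := by
  rw [mhat_eq, Nat.add_sub_cancel_left, min_eq_right hj]
  simp only [Finset.sum_range_succ, Finset.sum_range_zero, Nat.choose_zero_right, Nat.choose_one_right,
    add_zero, zero_add, one_mul]

/-- `C(2m+1, m+1+a)·C(m+1+a, a) = C(m, a)·C(2m+1, m+1)` (the term identity). -/
lemma choose_upper_mul_eq (m a : ℕ) :
    (2 * m + 1).choose (m + 1 + a) * (m + 1 + a).choose a = m.choose a * (2 * m + 1).choose (m + 1) := by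
  have h := Nat.choose_mul (n := 2 * m + 1) (k := m + 1 + a) (s := m + 1) (by omega)
  rw [show 2 * m + 1 - (m + 1) = m by omega, show m + 1 + a - (m + 1) = a by omega] at h
  rw [show (m + 1 + a).choose a = (m + 1 + a).choose (m + 1) by
    rw [show m + 1 + a = a + (m + 1) by ring]; exact Nat.choose_symm_add]
  rw [h, mul_comm]

/-- `(a+1)·C(m+1+a, a+1) = (m+1)·C(m+1+a, a)`. -/
lemma succ_mul_choose_succ_eq (m a : ℕ) :
    (a + 1) * (m + 1 + a).choose (a + 1) = (m + 1) * (m + 1 + a).choose a := by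
  have h := Nat.choose_succ_right_eq (m + 1 + a) a
  rw [show m + 1 + a - a = m + 1 by omega] at h
  rw [mul_comm, h, mul_comm]

/-- The `j ≥ 2` chord bound, in `ℕ`: `(a+1)·C(2m+1, m+1+a)·m̂ ≤ C(m, a)·C(2m+1, m+1)·((j+1)(m+1))`. -/
lemma term_chord_nat (m a j : ℕ) (ha : a ≤ m) (hj : 1 ≤ j) :
    (a + 1) * (2 * m + 1).choose (m + 1 + a) * mhat (m + 1) m a j
      ≤ m.choose a * ((2 * m + 1).choose (m + 1) * ((j + 1) * (m + 1))) := by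
  rw [mhat_pred m a j hj]
  have h1 := choose_upper_mul_eq m a
  have h2 := succ_mul_choose_succ_eq m a
  set W := (2 * m + 1).choose (m + 1 + a)
  set X := (m + 1 + a).choose a
  set Y := (m + 1 + a).choose (a + 1)
  set B := (2 * m + 1).choose (m + 1)
  set c := m.choose a
  have e : (a + 1) * W * (X + j * Y) = c * B * (a + 1 + j * (m + 1)) := by
    calc (a + 1) * W * (X + j * Y) = W * X * (a + 1) + j * W * ((a + 1) * Y) := by ring
      _ = W * X * (a + 1) + j * W * ((m + 1) * X) := by rw [h2]
      _ = (W * X) * (a + 1 + j * (m + 1)) := by ring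
      _ = c * B * (a + 1 + j * (m + 1)) := by rw [h1]
  rw [e, mul_assoc]
  apply Nat.mul_le_mul_left
  apply Nat.mul_le_mul_left
  nlinarith

/-- The `j = 1` term identity, in `ℕ`: `C(m, a)·C(2m+1, m+1)·(2m+2) = (a+1)·C(2m+2, m+2+a)·m̂(m+1, m; a, 1)`. -/
lemma term_one_nat (m a : ℕ) :
    m.choose a * (2 * m + 1).choose (m + 1) * (2 * m + 2)
      = (a + 1) * (2 * m + 2).choose (m + 2 + a) * mhat (m + 1) m a 1 := by
  rw [mhat_pred m a 1 le_rfl, one_mul]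
  have h1 := choose_upper_mul_eq m a
  have h2 := succ_mul_choose_succ_eq m a
  have h3 : (2 * m + 2) * (2 * m + 1).choose (m + 1 + a) = (2 * m + 2).choose (m + 2 + a) * (m + 2 + a) := by
    have h := Nat.add_one_mul_choose_eq (2 * m + 1) (m + 1 + a)
    rw [show 2 * m + 2 = 2 * m + 1 + 1 by ring, show m + 2 + a = m + 1 + a + 1 by ring]
    exact h
  set W := (2 * m + 1).choose (m + 1 + a)
  set X := (m + 1 + a).choose a
  set Y := (m + 1 + a).choose (a + 1)
  set B := (2 * m + 1).choose (m + 1)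
  set c := m.choose a
  set V := (2 * m + 2).choose (m + 2 + a)
  calc c * B * (2 * m + 2) = (2 * m + 2) * (W * X) := by rw [← h1]; ring
    _ = V * (m + 2 + a) * X := by rw [← mul_assoc, h3]
    _ = V * ((a + 1) * X + (m + 1) * X) := by ring
    _ = V * ((a + 1) * X + (a + 1) * Y) := by rw [← h2]
    _ = (a + 1) * V * (X + Y) := by ring

/-! ### §4 The core inequality (★) on the slice, for each `j` -/

/-- `m̂(m+1, m; a, j) > 0` for `j ≥ 1` (its first term is `C(m+1+a, a) ≥ 1`). -/
lemma mhat_pred_pos (m a j : ℕ) (hj : 1 ≤ j) : 0 < mhat (m + 1) m a j := by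
  rw [mhat_pred m a j hj]
  have := Nat.choose_pos (show a ≤ m + 1 + a by omega)
  omega

/-- `j = 1`: the slice sum is exactly `1/2` (we only need `≥`). -/
lemma sliceSum_one_ge (m : ℕ) :
    (1 : ℚ) / 2 ≤ ∑ a ∈ range (m + 1), (m.choose a : ℚ) / (mhat (m + 1) m a 1 : ℚ) := by
  have hB : 0 < (2 * m + 1).choose (m + 1) := Nat.choose_pos (by omega)
  have hterm : ∀ a ∈ range (m + 1),
      (((a + 1) * (2 * m + 2).choose (m + 2 + a) : ℕ) : ℚ) / (((2 * m + 1).choose (m + 1) * (2 * m + 2) : ℕ) : ℚ)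
        ≤ (m.choose a : ℚ) / (mhat (m + 1) m a 1 : ℚ) := by
    intro a _
    rw [div_le_div_iff₀ (by positivity) (by exact_mod_cast mhat_pred_pos m a 1 le_rfl)]
    have h := term_one_nat m a
    have h' : (((a + 1) * (2 * m + 2).choose (m + 2 + a) * mhat (m + 1) m a 1 : ℕ) : ℚ)
        = ((m.choose a * ((2 * m + 1).choose (m + 1) * (2 * m + 2)) : ℕ) : ℚ) := by
      rw [← h]; push_cast; ring
    push_cast at h' ⊢
    linarith [h']
  refine le_trans ?_ (Finset.sum_le_sum hterm)
  rw [← Finset.sum_div]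
  have hS : (∑ a ∈ range (m + 1), (((a + 1) * (2 * m + 2).choose (m + 2 + a) : ℕ) : ℚ))
      = (((m + 1) * (2 * m + 1).choose (m + 1) : ℕ) : ℚ) := by
    rw [← Nat.cast_sum, sum_succ_mul_choose_even_upper m]
  rw [hS, div_le_div_iff₀ (by norm_num) (by positivity)]
  push_cast
  nlinarith

/-- `j ≥ 2`: the slice sum is at least `2(m+j+2)/((m+2)(j+1)(j+2))`. -/
lemma sliceSum_ge (m j : ℕ) (hj : 2 ≤ j) :
    (2 * (m + j + 2) : ℚ) / ((m + 2) * ((j + 1) * (j + 2)))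
      ≤ ∑ a ∈ range (m + 1), (m.choose a : ℚ) / (mhat (m + 1) m a j : ℚ) := by
  have hB : 0 < (2 * m + 1).choose (m + 1) := Nat.choose_pos (by omega)
  have hterm : ∀ a ∈ range (m + 1),
      (((a + 1) * (2 * m + 1).choose (m + 1 + a) : ℕ) : ℚ)
          / (((2 * m + 1).choose (m + 1) * ((j + 1) * (m + 1)) : ℕ) : ℚ)
        ≤ (m.choose a : ℚ) / (mhat (m + 1) m a j : ℚ) := by
    intro a ha
    rw [Finset.mem_range] at ha
    rw [div_le_div_iff₀ (by positivity) (by exact_mod_cast mhat_pred_pos m a j (by omega))]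
    have h := term_chord_nat m a j (by omega) (by omega)
    exact_mod_cast h
  refine le_trans ?_ (Finset.sum_le_sum hterm)
  rw [← Finset.sum_div]
  have hS : (2 * ∑ a ∈ range (m + 1), (((a + 1) * (2 * m + 1).choose (m + 1 + a) : ℕ) : ℚ))
      = ((4 ^ m + (m + 1) * (2 * m + 1).choose (m + 1) : ℕ) : ℚ) := by
    rw [← Nat.cast_sum, ← two_mul_sum_succ_mul_choose_upper m]; push_cast; ring
  have hF := two_mul_succ_mul_choose_le m
  rw [div_le_div_iff₀ (by positivity) (by positivity)]
  generalize hS1 : (∑ a ∈ range (m + 1), (((a + 1) * (2 * m + 1).choose (m + 1 + a) : ℕ) : ℚ)) = S1 at hS ⊢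
  generalize hBd : (2 * m + 1).choose (m + 1) = B at hS hF hB ⊢
  push_cast at hS ⊢
  have hF' : (2 : ℚ) * (m + 1) * B ≤ 4 ^ m * (m + 2) := by exact_mod_cast hF
  have hj' : (2 : ℚ) ≤ j := by exact_mod_cast hj
  have hB' : (0 : ℚ) ≤ B := by positivity
  have hm' : (0 : ℚ) ≤ m := by positivity
  have hm1 : (0 : ℚ) ≤ m + 1 := by positivity
  have hj1 : (0 : ℚ) ≤ j + 1 := by positivity
  have hj2 : (0 : ℚ) ≤ j + 2 := by positivity
  have t1 : 2 * ((m : ℚ) + 1) * B * (j + 2) ≤ 4 ^ m * (m + 2) * (j + 2) :=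
    mul_le_mul_of_nonneg_right hF' hj2
  have t2 : (0 : ℚ) ≤ (m + 1) * B * (m * (j - 2)) :=
    mul_nonneg (mul_nonneg hm1 hB') (mul_nonneg hm' (sub_nonneg.mpr hj'))
  have core : 4 * ((m : ℚ) + j + 2) * ((m + 1) * B) ≤ (4 ^ m + (m + 1) * B) * ((m + 2) * (j + 2)) := by
    nlinarith [t1, t2]
  have core' := mul_le_mul_of_nonneg_left core hj1
  have hS' : ((j : ℚ) + 1) * ((4 ^ m + (m + 1) * B) * ((m + 2) * (j + 2)))
      = (j + 1) * ((2 * S1) * ((m + 2) * (j + 2))) := by rw [hS]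
  nlinarith [core', hS']

/-! ### §5 The `Φ`-side bound and the theorem -/

/-- `Φ_j ≤ C(k+1, j)·2(m+j+2)/((m+2)(j+1)(j+2))` for `1 ≤ j`, `j + 1 ≤ k`, in the cross-multiplied `ℕ` form. -/
lemma phi_term_nat (m j k : ℕ) (hjk : j + 1 ≤ k) :
    (m + 1 + k).choose j * ((m + 2) * ((j + 1) * (j + 2)))
      ≤ (k + 1).choose j * (2 * (m + j + 2)) * (m + 1 + j).choose (m + 1) := by
  have hA := choose_ratio_le_of_succ_le (m + 1) j (by omega) k hjk
  rw [show m + 1 + j + 1 = m + j + 2 by ring] at hA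
  have hsym : (m + 1 + j).choose (m + 1) = (m + 1 + j).choose j := Nat.choose_symm_add
  have hratio : (m + 1 + j).choose j * (m + j + 2) = (m + j + 2).choose j * (m + 2) := by
    have h := Nat.choose_mul_succ_eq (m + 1 + j) j
    rw [show m + 1 + j + 1 = m + j + 2 by ring, show m + j + 2 - j = m + 2 by omega] at h
    exact h
  have hP : (j + 1) * (j + 2) = 2 * (j + 2).choose j := by
    have h := Nat.add_one_mul_choose_eq (j + 1) 1
    rw [Nat.choose_one_right] at h
    have hs : (j + 2).choose j = (j + 2).choose 2 := Nat.choose_symm_add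
    rw [hs, show j + 2 = j + 1 + 1 by ring]
    rw [show (1 : ℕ) + 1 = 2 by rfl] at h
    rw [mul_comm (j + 1) (j + 1 + 1), h, mul_comm]
  rw [hsym, hP]
  calc (m + 1 + k).choose j * ((m + 2) * (2 * (j + 2).choose j))
      = ((m + 1 + k).choose j * (j + 2).choose j) * (2 * (m + 2)) := by ring
    _ ≤ ((m + j + 2).choose j * (k + 1).choose j) * (2 * (m + 2)) := Nat.mul_le_mul_right _ hA
    _ = (k + 1).choose j * 2 * ((m + j + 2).choose j * (m + 2)) := by ring
    _ = (k + 1).choose j * 2 * ((m + 1 + j).choose j * (m + j + 2)) := by rw [hratio]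
    _ = (k + 1).choose j * (2 * (m + j + 2)) * (m + 1 + j).choose j := by ring

/-- The termwise inequality: for `1 ≤ j`, `j + 1 ≤ k`,
`C(m+1+k, j)/C(m+1+j, m+1) ≤ Σ_{a ≤ m} C(m, a)·C(k+1, j)/m̂(m+1, m; a, j)`. -/
lemma slice_term_le (m j k : ℕ) (hj : 1 ≤ j) (hjk : j + 1 ≤ k) :
    ((m + 1 + k).choose j : ℚ) / ((m + 1 + j).choose (m + 1) : ℚ)
      ≤ ∑ a ∈ range (m + 1), ((m.choose a * (k + 1).choose j : ℕ) : ℚ) / (mhat (m + 1) m a j : ℚ) := by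
  have hR : ∑ a ∈ range (m + 1), ((m.choose a * (k + 1).choose j : ℕ) : ℚ) / (mhat (m + 1) m a j : ℚ)
      = ((k + 1).choose j : ℚ) * ∑ a ∈ range (m + 1), (m.choose a : ℚ) / (mhat (m + 1) m a j : ℚ) := by
    rw [Finset.mul_sum]
    refine Finset.sum_congr rfl (fun a _ => ?_)
    push_cast; ring
  rw [hR]
  have hΦ : ((m + 1 + k).choose j : ℚ) / ((m + 1 + j).choose (m + 1) : ℚ)
      ≤ ((k + 1).choose j : ℚ) * ((2 * (m + j + 2) : ℚ) / ((m + 2) * ((j + 1) * (j + 2)))) := by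
    rw [mul_div_assoc', div_le_div_iff₀ (by exact_mod_cast Nat.choose_pos (by omega)) (by positivity)]
    have h := phi_term_nat m j k hjk
    have h' : (((m + 1 + k).choose j * ((m + 2) * ((j + 1) * (j + 2))) : ℕ) : ℚ)
        ≤ (((k + 1).choose j * (2 * (m + j + 2)) * (m + 1 + j).choose (m + 1) : ℕ) : ℚ) := by
      exact_mod_cast h
    push_cast at h'
    linarith
  refine hΦ.trans ?_
  apply mul_le_mul_of_nonneg_left _ (by positivity)
  rcases Nat.lt_or_ge j 2 with hj2 | hj2
  · have hj1 : j = 1 := by omega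
    subst hj1
    refine le_trans ?_ (sliceSum_one_ge m)
    rw [div_le_div_iff₀ (by positivity) (by norm_num)]
    push_cast
    nlinarith
  · exact sliceSum_ge m j hj2

/-- **(R̂) on the slice `m = q − 1`**: `Φ(q+k, q) ≤ R̂(q, k, q−1)` for every `q ≥ 1`, `k ≥ 2`
(stated with `q = m + 1`). -/
theorem rhatCell_pred' (m k : ℕ) (hk : 2 ≤ k) : phiK (m + 1 + k) (m + 1) ≤ rhat (m + 1) k m := by
  rw [phiK_eq_sum_range (m + 1) k (by omega)]
  unfold rhat
  rw [sum_Ioo_nat]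
  simp only [zero_add]
  refine Finset.sum_le_sum (fun i hi => ?_)
  rw [Finset.mem_range] at hi
  rw [show 1 + i = i + 1 by ring, show m + 1 + k - m = k + 1 by omega,
    show m + 1 + i + 1 = m + 1 + (i + 1) by ring]
  exact slice_term_le m (i + 1) k (by omega) (by omega)

/-- **(R̂) on the slice `m = q − 1`** in the vocabulary of `RhatIneq`: `Φ(q+k, q) ≤ R̂(q, k, q−1)` for all `q ≥ 1`, `k ≥ 2`. -/
theorem rhatCell_pred (q k : ℕ) (hq : 1 ≤ q) (hk : 2 ≤ k) : phiK (q + k) q ≤ rhat q k (q - 1) := by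
  obtain ⟨m, rfl⟩ : ∃ m, q = m + 1 := ⟨q - 1, by omega⟩
  rw [Nat.add_sub_cancel]
  exact rhatCell_pred' m k hk

variable {α : Type} (M : Matroid α) [M.Finite]

/-- **Rule Q pays `Φ` to every member with `#P = q − 1`** of every finite matroid at the tight layer of the cell `(q+k, q)`:
with RankLevelSetRuleQCellOne (`#P ≤ 1`) and `ruleQRecv_ge_of_flatPart_eq` (`#P = q`), the equal split is a mechanism
for the UP form at every member with `#P ∈ {0, 1, q−1, q}`. -/
theorem ruleQRecv_ge_of_flatPart_eq_pred {q k : ℕ} (hq : 1 ≤ q) (hk : 2 ≤ k) (hE : M.E.ncard = (q + k) + q)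
    {Z : Set α} (hZ : Z ∈ cellMembers M (q + k) q) (hP : (flatPart M Z).ncard = q - 1) :
    phiK (q + k) q ≤ ruleQRecv M (q + k) q Z := by
  refine le_trans ?_ (rhat_le_ruleQRecv M hE hZ)
  rw [hP]
  exact rhatCell_pred q k hq hk

end PercRepro
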